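import Mathlib
import HarnessLib
import Summits.Ventures.LatticeQCDFlow.Exactness.NCMCGeneralSpaceReplicaPooledGammaCoverage

/-!
# Independent replicas realised on ANY probability space: the pooled CLT and the exactness of the pooled Γ-method error bar transfer verbatim from the product law (the bridge to row 8's `iIndepFun` modelling of replica chains)

HONEST FRAMING: exact (Metropolis-corrected) sampling algorithms for lattice gauge theory;
figures of merit are autocorrelation/cost numbers at stated couplings and volumes; no
continuum-physics claim.

Venture `LatticeQCDFlow` (cell pub-lqcd), topic `Exactness`; FANOUT row 13 (`eng-snf`, GEN-23).
NEW WORK of the cell, not a published result; no definition is introduced; nothing is cited as a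
fact.  GEN-23's replica files (`NCMCGeneralSpaceReplicaSumCLT`, `…ReplicaPooledCLT`,
`…ReplicaPooledGammaCoverage`, `…ReplicaPooledJarzynski…`) state every pooled theorem under the
PRODUCT law `Measure.pi (r ↦ P_{μ r})` on `ι → (ℕ → S)` — the canonical model of `R` independent
streams.  Row 8 (`Scoring/ReplicaChains.lean`) models replicas instead as mutually independent random
paths `X r : Ω₀ → (ℕ → S)` with laws `P_{μ r}` on an arbitrary probability space (Mathlib `iIndepFun`).
The two are the same: by Mathlib's `iIndepFun_iff_map_fun_eq_pi_map` the joint map `ω ↦ (r ↦ X r ω)`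
has law `Measure.pi (r ↦ law(X r))`, so every statement about probabilities of measurable events of
the joint path and every convergence in distribution of measurable statistics of it transfers by
`Measure.map`.  This file records the three transfer lemmas and instantiates them on the pooled CLT
and on the pooled Γ-method interval; the Jarzynski-lane statements transfer by the same one-liners.

## Content

* `map_joint_eq_pi`, **`measure_joint_mem_eq_pi`**, **`tendsto_measure_joint_mem_of_pi`**,
  **`tendstoInDistribution_joint_of_pi`** — generic (`X r : Ω₀ → β r` measurable, `iIndepFun X P`,
  `P.map (X r) = Q r`).
* **`tendstoInDistribution_sqrt_mul_pooledMean_sub_of_iIndepFun`** — independent replica CHAINS with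
  laws `P_{μ r}` on `(Ω₀, P)`: `√(R n) (x̄_{R,n} − πf) ⇒ N(0, σ²_f)` under `P`.
* **`tendsto_measure_pooledMean_mem_gammaInterval_of_iIndepFun`** — the printed pooled interval
  `x̄_{R,n} ± z √(V̂_{R,n}/(R n))` covers `πf` with `P`-probability → `gaussianReal 0 1 (Icc (−z) z)`.

NOT CLAIMED: dependent replicas; anything numerical.
-/

namespace Summit.Ventures.LatticeQCDFlow.Exactness.GeneralNCMC

open MeasureTheory ProbabilityTheory Set Filter Finset
open scoped ENNReal NNReal Topology

/-! ## §1 Transfer lemmas -/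

section Transfer

variable {Ω₀ : Type*} [MeasurableSpace Ω₀] {P : Measure Ω₀} [IsProbabilityMeasure P]
  {ι : Type*} [Fintype ι] {β : ι → Type*} [∀ r, MeasurableSpace (β r)]
  {X : (r : ι) → Ω₀ → β r} {Q : (r : ι) → Measure (β r)}

/-- The joint map of independent replicas with laws `Q r` has law `⊗_r Q r`. -/
theorem map_joint_eq_pi (hX : ∀ r, Measurable (X r)) (hind : iIndepFun X P)
    (hlaw : ∀ r, P.map (X r) = Q r) :
    P.map (fun (ω : Ω₀) (r : ι) => X r ω) = Measure.pi Q := by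
  rw [(iIndepFun_iff_map_fun_eq_pi_map (fun r => (hX r).aemeasurable)).1 hind]
  exact congrArg Measure.pi (funext hlaw)

/-- **Independent replicas realised on any probability space have the product law**: for measurable,
mutually independent `X r : Ω₀ → β r` and a measurable set `E` of joint values,
`P{ω | (r ↦ X r ω) ∈ E} = (⊗_r law(X r)) E`. -/
theorem measure_joint_mem_eq_pi (hX : ∀ r, Measurable (X r)) (hind : iIndepFun X P)
    (hlaw : ∀ r, P.map (X r) = Q r) {E : Set ((r : ι) → β r)} (hE : MeasurableSet E) :
    P {ω | (fun r => X r ω) ∈ E} = Measure.pi Q E := by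
  have hjoint : Measurable fun (ω : Ω₀) (r : ι) => X r ω := measurable_pi_lambda _ hX
  rw [← map_joint_eq_pi hX hind hlaw, Measure.map_apply hjoint hE]
  rfl

/-- **Limits of probabilities transfer** from the product law to any realisation by independent
replicas: if `(⊗_r law(X r)) (E n) → L` then `P{(r ↦ X r ·) ∈ E n} → L`. -/
theorem tendsto_measure_joint_mem_of_pi (hX : ∀ r, Measurable (X r)) (hind : iIndepFun X P)
    (hlaw : ∀ r, P.map (X r) = Q r) {E : ℕ → Set ((r : ι) → β r)} (hE : ∀ n, MeasurableSet (E n))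
    {L : ℝ≥0∞} (h : Tendsto (fun n => Measure.pi Q (E n)) atTop (𝓝 L)) :
    Tendsto (fun n => P {ω | (fun r => X r ω) ∈ E n}) atTop (𝓝 L) := by
  refine h.congr fun n => ?_
  exact (measure_joint_mem_eq_pi hX hind hlaw (hE n)).symm

/-- **Convergence in distribution transfers** from the product law to any realisation by independent
replicas. -/
theorem tendstoInDistribution_joint_of_pi [∀ r, IsProbabilityMeasure (Q r)]
    (hX : ∀ r, Measurable (X r)) (hind : iIndepFun X P) (hlaw : ∀ r, P.map (X r) = Q r) {F : ℕ → ((r : ι) → β r) → ℝ} (hF : ∀ n, Measurable (F n))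
    {Ω' : Type*} [MeasurableSpace Ω'] {P' : Measure Ω'} [IsProbabilityMeasure P'] {Z : Ω' → ℝ}
    (h : TendstoInDistribution F atTop Z (fun _ => Measure.pi Q) P') :
    TendstoInDistribution (fun n ω => F n (fun r => X r ω)) atTop Z (fun _ => P) P' := by
  have hjoint : Measurable fun (ω : Ω₀) (r : ι) => X r ω := measurable_pi_lambda _ hX
  have hpi := map_joint_eq_pi hX hind hlaw
  refine ⟨fun n => ((hF n).comp hjoint).aemeasurable, h.aemeasurable_limit, ?_⟩
  have ht := h.tendsto
  have heq : ∀ n, (⟨P.map (fun ω => F n (fun r => X r ω)),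
      Measure.isProbabilityMeasure_map ((hF n).comp hjoint).aemeasurable⟩ : ProbabilityMeasure ℝ)
      = ⟨(Measure.pi Q).map (F n), Measure.isProbabilityMeasure_map (h.forall_aemeasurable n)⟩ := by
    intro n
    apply Subtype.ext
    show P.map (fun ω => F n (fun r => X r ω)) = (Measure.pi Q).map (F n)
    rw [← hpi, Measure.map_map (hF n) hjoint]
    rfl
  simp only [heq]
  exact ht

end Transfer

/-! ## §2 Independent replica chains on any probability space -/

section Chains

variable {S : Type*} [MeasurableSpace S]
  {κ : Kernel S S} [IsMarkovKernel κ] {π : Measure S} [IsProbabilityMeasure π]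
  {ν : Measure S} [IsProbabilityMeasure ν] {ε : ℝ≥0∞} {m : ℕ}
  {ι : Type*} [Fintype ι] [Nonempty ι]
  {Ω₀ : Type*} [MeasurableSpace Ω₀] {P : Measure Ω₀} [IsProbabilityMeasure P]

/-- **THE POOLED CLT FOR INDEPENDENT REPLICA CHAINS ON ANY PROBABILITY SPACE.**  `κ` Markov, `π`
invariant, `(nHit κ m)(z, ·) ≥ ε ν` (`ε ≠ 0`, `0 < m`), `|f| ≤ C`; `X r : Ω₀ → (ℕ → S)` measurable,
mutually independent under `P`, with `law(X r) = P_{μ r}` (row 8's chain law from ANY `μ r`).  For every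
`Y` with law `N(0, σ²_f)`: `√(R n) ((Σ_r Σ_{t<n} f(X r ω t))/(R n) − πf) ⇒ Y` under `P`. -/
theorem tendstoInDistribution_sqrt_mul_pooledMean_sub_of_iIndepFun (hπ : Kernel.Invariant κ π)
    (hε : ε ≠ 0) (hmin : ∀ z, ε • ν ≤ nHit κ m z) (hm : 0 < m)
    {f : S → ℝ} (hf : Measurable f) {C : ℝ} (hC : ∀ x, |f x| ≤ C)
    (μ : ι → Measure S) [∀ r, IsProbabilityMeasure (μ r)]
    {X : ι → Ω₀ → (ℕ → S)} (hX : ∀ r, Measurable (X r)) (hind : iIndepFun X P)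
    (hlaw : ∀ r, P.map (X r) = Kernel.trajMeasure (X := fun _ : ℕ => S) (μ r)
        (fun n : ℕ => κ.comap (fun hh : (i : ↥(Finset.Iic n)) → S => hh ⟨n, Finset.mem_Iic.2 le_rfl⟩)
          (measurable_pi_apply _)))
    {Ω' : Type*} [MeasurableSpace Ω'] {P' : Measure Ω'} [IsProbabilityMeasure P'] {Y : Ω' → ℝ}
    (hY : HasLaw Y (gaussianReal 0 (Real.toNNReal (Scoring.autocov κ π (fun y => f y - ∫ z, f z ∂π) 0
        + 2 * ∑' t, Scoring.autocov κ π (fun y => f y - ∫ z, f z ∂π) (t + 1)))) P')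
    [∀ r, IsProbabilityMeasure (Kernel.trajMeasure (X := fun _ : ℕ => S) (μ r)
        (fun n : ℕ => κ.comap (fun hh : (i : ↥(Finset.Iic n)) → S => hh ⟨n, Finset.mem_Iic.2 le_rfl⟩)
          (measurable_pi_apply _)))] :
    TendstoInDistribution (fun (n : ℕ) (ω : Ω₀) =>
        Real.sqrt ((Fintype.card ι : ℝ) * n)
          * ((∑ r, ∑ t ∈ range n, f (X r ω t)) / ((Fintype.card ι : ℝ) * n) - ∫ z, f z ∂π))
      atTop Y (fun _ => P) P' := by
  have h := tendstoInDistribution_sqrt_mul_pooledMean_sub_of_nHit hπ hε hmin hm hf hC μ hY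
  have hF : ∀ n : ℕ, Measurable fun x : ι → ℕ → S => Real.sqrt ((Fintype.card ι : ℝ) * n)
      * ((∑ r, ∑ t ∈ range n, f (x r t)) / ((Fintype.card ι : ℝ) * n) - ∫ z, f z ∂π) := fun n =>
    measurable_const.mul (((Finset.measurable_sum _ fun r _ => Finset.measurable_sum _ fun t _ =>
      hf.comp ((measurable_pi_apply t).comp (measurable_pi_apply r))).div_const _).sub
        measurable_const)
  exact tendstoInDistribution_joint_of_pi hX hind hlaw hF h

/-- **THE PRINTED POOLED Γ-METHOD INTERVAL IS ASYMPTOTICALLY EXACT FOR INDEPENDENT REPLICA CHAINS ON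
ANY PROBABILITY SPACE.**  Same chain hypotheses, `σ²_f > 0`, windows `W_n → ∞`, `W_n³/n → 0`, `z > 0`:
`P{ |x̄_{R,n} − πf| ≤ z √(V̂_{R,n}/(R n)) } → gaussianReal 0 1 (Icc (−z) z)`, the statistics being
computed on the replica paths `X r ω`. -/
theorem tendsto_measure_pooledMean_mem_gammaInterval_of_iIndepFun (hπ : Kernel.Invariant κ π)
    (hε : ε ≠ 0) (hmin : ∀ z, ε • ν ≤ nHit κ m z) (hm : 0 < m)
    {f : S → ℝ} (hf : Measurable f) {C : ℝ} (hC : ∀ x, |f x| ≤ C)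
    (hσ : 0 < Scoring.autocov κ π (fun y => f y - ∫ z, f z ∂π) 0
        + 2 * ∑' t, Scoring.autocov κ π (fun y => f y - ∫ z, f z ∂π) (t + 1))
    {W : ℕ → ℕ} (hW : Tendsto W atTop atTop) (hW3 : Tendsto (fun N => (W N : ℝ) ^ 3 / N) atTop (𝓝 0))
    (μ : ι → Measure S) [∀ r, IsProbabilityMeasure (μ r)] {z : ℝ} (hz : 0 < z)
    {X : ι → Ω₀ → (ℕ → S)} (hX : ∀ r, Measurable (X r)) (hind : iIndepFun X P)
    (hlaw : ∀ r, P.map (X r) = Kernel.trajMeasure (X := fun _ : ℕ => S) (μ r)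
        (fun n : ℕ => κ.comap (fun hh : (i : ↥(Finset.Iic n)) → S => hh ⟨n, Finset.mem_Iic.2 le_rfl⟩)
          (measurable_pi_apply _)))
    [∀ r, IsProbabilityMeasure (Kernel.trajMeasure (X := fun _ : ℕ => S) (μ r)
        (fun n : ℕ => κ.comap (fun hh : (i : ↥(Finset.Iic n)) → S => hh ⟨n, Finset.mem_Iic.2 le_rfl⟩)
          (measurable_pi_apply _)))] :
    Tendsto (fun n : ℕ => P {ω : Ω₀ |
        |(∑ r, ∑ t ∈ range n, f (X r ω t)) / ((Fintype.card ι : ℝ) * n) - ∫ z, f z ∂π|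
          ≤ z * Real.sqrt (((∑ r, Scoring.gammaHat (fun i => f (X r ω i)) n 0
            * (2 * Scoring.tauIntWindow (Scoring.rhoHat (fun i => f (X r ω i)) n) (W n)))
              / Fintype.card ι) / ((Fintype.card ι : ℝ) * n))})
      atTop (𝓝 (gaussianReal 0 1 (Icc (-z) z))) := by
  have h := tendsto_measure_pooledMean_mem_gammaInterval_of_nHit hπ hε hmin hm hf hC hσ hW hW3 μ hz
  have hE : ∀ n : ℕ, MeasurableSet {x : ι → ℕ → S |
      |(∑ r, ∑ t ∈ range n, f (x r t)) / ((Fintype.card ι : ℝ) * n) - ∫ z, f z ∂π|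
        ≤ z * Real.sqrt (((∑ r, Scoring.gammaHat (fun i => f (x r i)) n 0
          * (2 * Scoring.tauIntWindow (Scoring.rhoHat (fun i => f (x r i)) n) (W n)))
            / Fintype.card ι) / ((Fintype.card ι : ℝ) * n))} := by
    intro n
    refine measurableSet_le ?_ ?_
    · exact (((Finset.measurable_sum _ fun r _ => Finset.measurable_sum _ fun t _ =>
        hf.comp ((measurable_pi_apply t).comp (measurable_pi_apply r))).div_const _).sub
          measurable_const).abs
    · exact measurable_const.mul ((measurable_pooledGammaWindow hf n (W n)).div_const _).sqrt
  exact tendsto_measure_joint_mem_of_pi hX hind hlaw hE h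

end Chains

end Summit.Ventures.LatticeQCDFlow.Exactness.GeneralNCMC
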